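import Mathlib.Algebra.MvPolynomial.NoZeroDivisors
import Literature.Computability.AlgebraicComplexity.DeterminantalComplexity
import Literature.Computability.AlgebraicComplexity.StandardFamiliesProofs
import Literature.Computability.AlgebraicComplexity.RankOneDeterminantalExpressionsProofs
import Literature.LinearAlgebra.Matrix.MvPolynomialDetDegree

/-!
# `UlrichPadded.OrbitCorankTwo` (stmt-ValiantsHypothesis-15032): the size boundary `m = n`

Negative knowledge for the crux (standing disprover, cycle 1, 2026-08-16), Literature-only.
`exists_adjugate_linPart_notMem_of_size`: for EVERY `n ≥ 1` and every `n × n` matrix `B` of affine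
linear forms with `det B = per_n`, some submaximal minor of the linear part of `B` lies outside `(per_n)`
— in every gauge, with no orbit argument: the minors have degree `≤ n - 1 < n`, so membership forces
`adj L = 0`, `det L = 0`, while `det L` is the degree-`n` component of `det B = per_n ≠ 0`
(`homogeneousComponent_det_affine`).  Hence the conclusion of `OrbitCorankTwo` is never available at
`m = n`; the crux therefore contains `¬ HasDetRepr per_n n` for `n ≥ 3` (the route's support item
NoGlobalSplitting, proved in tree from Mignon–Ressayre) and all of its content sits at sizes `m ≥ n + 1`.
This generalises `exists_adjugate_linPart_notMem_two` (`Negative/FalseFromTwo.lean`) from `n = 2` to all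
`n`.  Inline statements, Literature-only imports (independent of the route file), no new facts.
-/

noncomputable section

namespace Summit.ValiantsHypothesis.Theorems.OrbitCorankTwoNegative

open MvPolynomial Matrix
open Literature.Computability.AlgebraicComplexity

/-- An affine-linear polynomial is its constant term plus its linear part. [folklore] -/
theorem eq_C_add_homogeneousComponent_one {σ : Type*} (φ : MvPolynomial σ ℂ)
    (h1 : φ.totalDegree ≤ 1) : φ = C (coeff 0 φ) + homogeneousComponent 1 φ := by
  rcases Nat.lt_or_ge φ.totalDegree 1 with hlt | hge
  · rw [homogeneousComponent_eq_zero 1 φ hlt, add_zero]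
    exact totalDegree_eq_zero_iff_eq_C.1 (by omega)
  · have hd : φ.totalDegree = 1 := le_antisymm h1 hge
    have hs := sum_homogeneousComponent φ
    rw [hd, Finset.sum_range_succ, Finset.sum_range_one, homogeneousComponent_zero] at hs
    exact hs.symm

/-- Top homogeneous component of `l * ψ` for a linear form `l`. [folklore] -/
theorem homogeneousComponent_succ_linear_mul {σ : Type*} {l : MvPolynomial σ ℂ}
    (hl : l.IsHomogeneous 1) (ψ : MvPolynomial σ ℂ) {k : ℕ} (hψ : ψ.totalDegree ≤ k) :
    homogeneousComponent (k + 1) (l * ψ) = l * homogeneousComponent k ψ := by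
  conv_lhs => rw [← sum_homogeneousComponent ψ]
  rw [Finset.mul_sum, map_sum]
  have key : ∀ i ∈ Finset.range (ψ.totalDegree + 1),
      homogeneousComponent (k + 1) (l * homogeneousComponent i ψ) =
        if i = k then l * homogeneousComponent k ψ else 0 := by
    intro i _
    have hmem : l * homogeneousComponent i ψ ∈ homogeneousSubmodule σ ℂ (i + 1) := by
      have := hl.mul (homogeneousComponent_isHomogeneous i ψ)
      rwa [add_comm] at this
    rw [homogeneousComponent_of_mem hmem]
    by_cases hik : i = k
    · subst hik; simp
    · have hki : ¬ k = i := fun h => hik h.symm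
      simp [hik, hki]
  rw [Finset.sum_congr rfl key, Finset.sum_ite_eq']
  split_ifs with hk
  · rfl
  · rw [Finset.mem_range, not_lt] at hk
    rw [homogeneousComponent_eq_zero k ψ (by omega), mul_zero]

/-- The top homogeneous component of a product of affine factors `C aᵢ + lᵢ` (`lᵢ` linear forms) is the
product of the linear parts. [folklore] -/
theorem homogeneousComponent_prod_affine {σ ι : Type*} (s : Finset ι) (a : ι → ℂ)
    (l : ι → MvPolynomial σ ℂ) (hl : ∀ i, (l i).IsHomogeneous 1) :
    homogeneousComponent s.card (∏ i ∈ s, (C (a i) + l i)) = ∏ i ∈ s, l i := by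
  classical
  induction s using Finset.induction_on with
  | empty => simp
  | insert j s hj ih =>
    have hdeg : (∏ i ∈ s, (C (a i) + l i)).totalDegree ≤ s.card := by
      refine (totalDegree_finsetProd _ _).trans ?_
      rw [Finset.card_eq_sum_ones]
      exact Finset.sum_le_sum fun i _ =>
        (totalDegree_add _ _).trans (max_le (by simp) (hl i).totalDegree_le)
    rw [Finset.prod_insert hj, Finset.prod_insert hj, Finset.card_insert_of_notMem hj, add_mul, map_add,
      homogeneousComponent_C_mul, homogeneousComponent_eq_zero _ _ (by omega), mul_zero, zero_add,
      homogeneousComponent_succ_linear_mul (hl j) _ hdeg, ih]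

/-- The degree-`n` homogeneous component of the determinant of an `n × n` matrix of affine linear forms
`C cᵢⱼ + Lᵢⱼ` is the determinant of its linear part `L`. [folklore] -/
theorem homogeneousComponent_det_affine {ι σ : Type*} [Fintype ι] [DecidableEq ι]
    (c : Matrix ι ι ℂ) (L : Matrix ι ι (MvPolynomial σ ℂ)) (hL : ∀ i j, (L i j).IsHomogeneous 1) :
    homogeneousComponent (Fintype.card ι) (Matrix.of fun i j => C (c i j) + L i j).det = L.det := by
  rw [Matrix.det_apply', Matrix.det_apply', map_sum]
  refine Finset.sum_congr rfl fun τ _ => ?_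
  rw [show (((Equiv.Perm.sign τ : ℤˣ) : ℤ) : MvPolynomial σ ℂ) = C (((Equiv.Perm.sign τ : ℤˣ) : ℤ) : ℂ)
      from (map_intCast (C : ℂ →+* MvPolynomial σ ℂ) _).symm, homogeneousComponent_C_mul]
  congr 1
  have h := homogeneousComponent_prod_affine Finset.univ (fun i => c (τ i) i) (fun i => L (τ i) i)
    fun i => hL _ _
  rw [Finset.card_univ] at h
  simpa [Matrix.of_apply] using h

/-- **At `m = n` the conclusion of `OrbitCorankTwo` fails in every gauge, for every `n ≥ 1`.**  If `B` is
an `n × n` matrix of affine linear forms with `det B = per_n`, then some submaximal minor of the linear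
part of `B` is not in `(per_n)`: those minors have total degree `≤ n - 1`, so they would all vanish,
giving `adj L = 0`, `det L = 0`; but `det L` is the degree-`n` component of `det B = per_n ≠ 0`. [folklore] -/
theorem exists_adjugate_linPart_notMem_of_size {n : ℕ} (hn : 1 ≤ n)
    (B : Matrix (Fin n) (Fin n) (MvPolynomial (Fin n × Fin n) ℂ))
    (hB : IsAffineDetRepr (perPoly (Fin n) ℂ) B) :
    ∃ i j, (Matrix.of fun a b => homogeneousComponent 1 (B a b)).adjugate i j ∉
      Ideal.span {perPoly (Fin n) ℂ} := by
  by_contra hex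
  set Lb : Matrix (Fin n) (Fin n) (MvPolynomial (Fin n × Fin n) ℂ) :=
    Matrix.of fun a b => homogeneousComponent 1 (B a b) with hLb
  have hall : ∀ i j, Lb.adjugate i j ∈ Ideal.span {perPoly (Fin n) ℂ} := fun i j => by
    by_contra hij
    exact hex ⟨i, j, hij⟩
  -- the submaximal minors of the linear part have degree ≤ n - 1
  have hdegadj : ∀ i j, (Lb.adjugate i j).totalDegree ≤ n - 1 := by
    intro i j
    rw [Matrix.adjugate_apply, ← Matrix.det_transpose, ← Matrix.updateCol_transpose]
    have h := Literature.LinearAlgebra.Matrix.totalDegree_det_le (Lbᵀ.updateCol j (Pi.single i 1))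
      (fun c => if c ≠ j then 1 else 0) ?_
    · refine h.trans (le_of_eq ?_)
      rw [Finset.sum_boole, Finset.filter_ne', Finset.card_erase_of_mem (Finset.mem_univ _),
        Finset.card_univ, Fintype.card_fin]
      simp
    · intro r c
      rw [Matrix.updateCol_apply]
      by_cases hc : c = j
      · subst hc
        rw [if_pos rfl, if_neg (fun h => h rfl)]
        by_cases hr : r = i
        · subst hr; simp
        · simp [hr]
      · rw [if_neg hc, if_pos hc, Matrix.transpose_apply, hLb, Matrix.of_apply]
        exact (homogeneousComponent_isHomogeneous 1 _).totalDegree_le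
  -- a multiple of `per_n` of total degree `< n` vanishes (`per_n ≠ 0` is a form of degree `n`, `ℂ[x]` a domain)
  have low : ∀ q : MvPolynomial (Fin n × Fin n) ℂ, q ∈ Ideal.span {perPoly (Fin n) ℂ} →
      q.totalDegree < n → q = 0 := by
    intro q hq hdeg
    obtain ⟨k, rfl⟩ := Ideal.mem_span_singleton.1 hq
    by_contra hne
    have hk : k ≠ 0 := by
      rintro rfl
      exact hne (mul_zero _)
    have hper : perPoly (Fin n) ℂ ≠ 0 := perPoly_ne_zero (Fin n) ℂ
    have hdegper : (perPoly (Fin n) ℂ).totalDegree = n := by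
      simpa [Fintype.card_fin] using
        (perPoly_isHomogeneous (n := Fin n) (k := ℂ)).totalDegree hper
    rw [totalDegree_mul_of_isDomain hper hk, hdegper] at hdeg
    omega
  have hadj0 : Lb.adjugate = 0 := by
    funext i j
    exact low _ (hall i j) (lt_of_le_of_lt (hdegadj i j) (by omega))
  have hdetL : Lb.det = 0 := by
    have h := Matrix.mul_adjugate Lb
    rw [hadj0, Matrix.mul_zero] at h
    have h00 := congr_fun (congr_fun h ⟨0, hn⟩) ⟨0, hn⟩
    simp only [Matrix.zero_apply, Matrix.smul_apply, Matrix.one_apply_eq, smul_eq_mul, mul_one] at h00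
    exact h00.symm
  -- `B` = constant part + linear part, and the degree-`n` part of `det B` is `det Lb`
  obtain ⟨c, hc⟩ : ∃ c : Matrix (Fin n) (Fin n) ℂ, B = Matrix.of fun i j => C (c i j) + Lb i j :=
    ⟨Matrix.of fun i j => coeff 0 (B i j), Matrix.ext fun i j => by
      simpa [hLb] using eq_C_add_homogeneousComponent_one (B i j) (hB.1 i j)⟩
  have htop := homogeneousComponent_det_affine c Lb fun i j => by
    rw [hLb, Matrix.of_apply]; exact homogeneousComponent_isHomogeneous 1 (B i j)
  rw [← hc, hB.2, Fintype.card_fin, hdetL, homogeneousComponent_eq_self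
    (by simpa [Fintype.card_fin] using perPoly_isHomogeneous (n := Fin n) (k := ℂ))] at htop
  exact perPoly_ne_zero (Fin n) ℂ htop

/-- Corollary in the shape of the crux: for `n ≥ 1`, NO `n × n` affine representation `A` of `per_n`
admits `P, Q` with `P·A·Q` affine, `det = per_n` and all submaximal minors of the linear part of
`P·A·Q` in `(per_n)` — whatever `P, Q` are.  (For `n ≥ 3` there is no such `A` anyway — Mignon–Ressayre —
which is why the crux is consistent; for `n = 1, 2` this is the failure of the unguarded statement.) [folklore] -/
theorem orbitCorankTwo_conclusion_false_of_size_eq {n : ℕ} (hn : 1 ≤ n)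
    (A P Q : Matrix (Fin n) (Fin n) (MvPolynomial (Fin n × Fin n) ℂ))
    (h : IsAffineDetRepr (perPoly (Fin n) ℂ) (P * A * Q)) :
    ∃ i j, (Matrix.of fun a b => homogeneousComponent 1 ((P * A * Q) a b)).adjugate i j ∉
      Ideal.span {perPoly (Fin n) ℂ} :=
  exists_adjugate_linPart_notMem_of_size hn _ h

end Summit.ValiantsHypothesis.Theorems.OrbitCorankTwoNegative
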